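import Summits.Parity.GeneralizedHardyLittlewood.Theses.FordMaynardNoSieveConst0164

/-!
# Route `FordMaynardNoSieveConst0164` — assembly item `Assembly` (stmt-Parity-19105)

`Assembly := NegWitness0164 → PrimeFreeOfWitnessAtEta → NonposOfPrimeFree → NoSieveConst0164` is pure logic:
`NonposOfPrimeFree` at `(γ, θ, ν) = (1/2, 0, 41/250)` applied to the family of prime-free admissible sequences
`B ↦ PrimeFreeOfWitnessAtEta (1/2) (41/250) … NegWitness0164 B` (the `0 < B` guard of `NonposOfPrimeFree`'s
hypothesis is discarded, `PrimeFreeOfWitnessAtEta` gives every `B`); the side conditions `0 < 1/2 < 1`,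
`0 < 41/250 < 1` are `norm_num`.  Candidate term of record: planner p3 evidence `AssemblyF_holds.lean`
(pub/parity-ideate/parity-ideate-p3/evidence2/, sha16 9407615d7639c9f1), refuter re-check 2026-08-27 and
writer g19 farm re-check 2026-08-31 rc 0; landed verbatim by the decomp-parity landing hand
leafhand-parity-fmcert-1 g0.  No crux is touched; rung F-P1 bookkeeping, no summit motion.  Standard axioms only.
-/

namespace Summit.Parity.GeneralizedHardyLittlewood.Theses.FordMaynardNoSieveConst0164

/-- **`Assembly` holds** (route `FordMaynardNoSieveConst0164`, stmt-Parity-19105):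
`NegWitness0164 → PrimeFreeOfWitnessAtEta → NonposOfPrimeFree → NoSieveConst0164` — apply `NonposOfPrimeFree`
at `(1/2, 0, 41/250)` to the prime-free admissible sequences produced by `PrimeFreeOfWitnessAtEta` from the
negative Type-I* witness `NegWitness0164`. Pure glue. -/
theorem assembly_holds : Summit.Parity.GeneralizedHardyLittlewood.Theses.FordMaynardNoSieveConst0164.Assembly :=
  fun h1 h2 h3 c hc => h3 (1 / 2) 0 (41 / 250) c
    (fun B _ => h2 (1 / 2) (41 / 250) (by norm_num) (by norm_num) (by norm_num) (by norm_num) h1 B) hc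

end Summit.Parity.GeneralizedHardyLittlewood.Theses.FordMaynardNoSieveConst0164
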